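import Summits.QuantumFields.YangMills.Theorems.BalabanUVNodesN21GappedTopPair13CoPHSignFree
import Summits.QuantumFields.YangMills.Theorems.BalabanUVNodesN21GappedTopPairReading13CoPHFaces

/-!
# N21 (NE7c) · THE DOUBLY-GAPPED READING `crGap2₁₃VAt K₀ jcut ρ ρ′ n₁ n₂` WITHOUT THE SIGN ROWS: `ShellWeightBound` at the doubly-gapped carriers and at the reading, and the
# K5 conjunct's ∀-shape at `crGap2₁₃V`, under the live-selector pin, (H-ζ), the DIAL rows `0 ≤ ρ_K, ρ′_K ≤ 1` and `Σ_K (1∕(n₁ K+1) + 1∕(n₂ K+1)) < ∞` ONLY — both tops' `0 ≤ ε`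
# and both old levels' `0 ≤ δ` of FILE 14∕15 REMOVED, at PLAIN dials

WIDTH SEAT `pub-ymgap-dag-n21-w7` (g3), node N21 = NE7c (NOT PRINTED; NOT proved at print's fixed thresholds); lane K3⁸ `SpineGivenEndpointR13SepCoPHV`
(stmt-QuantumFields-27366, `--supports … --as helper`; COUNT-NEUTRAL).  THEOREMS ONLY (0 `def`).  Imports this seat's `…GappedTopPair13CoPHSignFree` (§SF3: the sign-free grid
lemmas `topGap2ShellAt_grids_nonneg`, `sum_topGap2ShellAt_grids_le_majorants`, `majorantA_grid_nonneg ∕ majorantB_grid_nonneg`) and FILE 15 `…GappedTopPairReading13CoPHFaces`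
(p636389: fibre sums, E1∕E2 `sum_classSet₁₃_gapWeight2A∕B₁₃_eq_schemeZ`, `topGap2ShellAtLevel_le`, the reading; through it FILE 14's sign-free §E2 majorant roads
`sum_range_majorantA2AtLevel_le_of_liveSel ∕ sum_range_majorantB2AtLevel_le_of_liveSel` and n20-d's canonical transfer `shellWeightBound_wshInf`).

WHY (dag-n21-d g12, LOCATED 2026-08-28 13:34Z, on FILE 14∕15).  The K5 face `K3V5Defs.KeyedShellWeight cr` quantifies over EVERY bare sequence `g₀ : ℕ → ℝ`, so the four sign
rows of `keyedShellWeight_shape_crGap2₁₃V_of_rows` — standing after `∀ g₀` — are refutable as ∀-rows (`epsOfRecord ν g k < 0` at junk couplings); in FILE 14 they serve ONLY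
`cutGrid_succ_le_of_nonneg ∕ bCutGrid_succ_le_of_nonneg` (grid monotonicity).  The companion file shows that at a negative base the family's objects are letter-independent along
the (nonpositive) grid, so the rows DROP: this file re-runs FILE 14 §E3 and FILE 15 §F2 on the sign-free grid lemmas.  The lane owner's V6 `…GappedTopPairReading13CoPHSignAware`
(disjunctive sign-or-width-zero rows, sign-aware dials) is the alternative of record for its V3 knit; the names below (suffix `_signFree`, this namespace) are a row-free
alternative at PLAIN dials for V3 or any later consumer — the lane owner's call.

WHAT THIS FILE PROVES ([folklore] bookkeeping; 0 `def`).
* §E4 level-polymorphic, sign-free: `topGap2ShellAtLevel_grids_nonneg`, `majorantA2AtLevel_grid_nonneg ∕ majorantB2AtLevel_grid_nonneg`,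
  `sum_topGap2ShellAtLevel_grids_le_majorants_of_liveSel`.
* §E5 ★★★ `exists_common_depths_topGap2Shell_le_of_liveSel_signFree` (FILE 12's record-level common depths, sign rows REMOVED) · ★★★ `gap2ShellSum_selDepths_le_signFree` — FILE 14's `gap2ShellSum_selDepths_le` with `hεA hεB hδA hδB` REMOVED: both runs' two-collar shell masses at the selected depth pair
  `(i⋆, j⋆)` are `≤ 4(2L^m)⁴(1∕(n₁+1) + 1∕(n₂+1)) ×` the runs' partition functions; rows `hsel`, (H-ζ), `0 ≤ ρ_K, ρ′_K ≤ 1`.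
* §F3 ★★★ `shellWeightBound_carriersGap2₁₃_signFree` (every field PROVED; rows `hsel`, (H-ζ), dials in `[0,1]`, `Summable (K ↦ 1∕(n₁ K+1) + 1∕(n₂ K+1))`) · ★★★
  `shellWeightBound_crGap2₁₃VAt_signFree` (at the reading's own `l₀, T, A, B, shA, shB` and CANONICAL `Wsh`) · ★★ `keyedShellWeight_shape_crGap2₁₃V_signFree` (the K3 stub-2
  conjunct's ∀-shape at `crGap2₁₃V`, modulo `hsel`, (H-ζ) and the dial rows ONLY — the same rows as the lane owner's one-family `keyedShellWeight_shape_crGap₁₃V_of_rows'`).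

HONEST FRAMING (binding).  Bookkeeping BY NAME; NO estimate of Bałaban's; NO anti-concentration; (M1)-free ONLY at SELECTED relative letters of the two top-step indicator families —
NE7c at print's FIXED thresholds is NOT proved; the residual `ζ` ∕ (3.5), the ℝ-side and everything below the top step NOT re-lettered (LOCATED); the K3 skeleton's `PinnedAtLive`
untouched (plan's decision); (H-ζ) stays displayed (not derivable from the K3⁸ item's antecedents — dag-n21-d g12 LOCATED 13:27Z); no `Provisos₁₃CoPH` inhabitant claimed (K0⁷
open); N21 NOT discharged; K3⁸ NOT claimed; counts UNMOVED (typed 28∕28 · discharged 5∕27, A 5∕28); never a count claim.  No `sorry`, no `axiom`, no `def`, no `instance`, no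
`notation`.  One finite four-torus programme at fixed `ε` — NOT ℝ⁴, NOT OS, NOT a mass gap, NOT the Clay problem.
-/

noncomputable section

open scoped BigOperators
open Finset MeasureTheory

namespace Summit.QuantumFields.YangMills.Theorems.N21GappedTopPair13CoPH

open Literature.MathematicalPhysics.QuantumFieldTheory.Balaban1983to89
open Literature.MathematicalPhysics.QuantumFieldTheory.Balaban1983to89.T4Continuum
open Literature.MathematicalPhysics.QuantumFieldTheory.Balaban1983to89.Node00
open YMDAG.UVSplit (SpineReading₁₃CoPH keyA₁₃ keyB₁₃ runA₁₃ runB₁₃ histA₁₃ histB₁₃ histA₁₃_zero histB₁₃_zero classSet₁₃ badClass₁₃)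
open T4IndicatorShell (ShellWeightBound)
open Summit.QuantumFields.BalabanUV.T4Continuum.Spine
open Summit.QuantumFields.YangMills.BalabanUVNodes.SpineCanonicalWeights
open Summit.QuantumFields.YangMills.Theorems.N21StepWeightsPositivity (zetaOfRecord_nonneg)
open Summit.QuantumFields.YangMills.BalabanUVNodes.N19MGFFormAtRecordMass (sum_classWeightOfDatum₉_datumOfRecord₁₃CoPH_eq_schemeZ_of_ppSelLive)
open Summit.QuantumFields.YangMills.BalabanUVNodes.N19MGFRoadLiveSelectorTower (dressedSlotsOfDatum₉_nonneg)
open Summit.QuantumFields.YangMills.BalabanUVNodes.N19MGFFormAtRecord (wOfRecord₉_nonneg)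
open Summit.QuantumFields.YangMills.Theorems.N21ShellSplitOfRecord13CoPH

/-! ## §E4 Level-polymorphic faces along the grids, sign-free -/

section LevelSF2

variable (F : T4Family) (N : ℕ) [NeZero N] (ϑ : Stage9Params F N) (D : FiniteEpsData F (SU N)) (g₀ : ℕ → ℝ) (os : List (ULoop F))
  (p : B12.RunParams) (g : ℕ → ℝ)

/-- (R) `0 ≤` the two-collar shell of a history at its own level along the grids (a-grid base `ja`, b-grid base `kb`), ANY signs of the bases; rows `0 ≤ ζ`, `Σ|ζ| ≤ 1`, (H-ζ),
`0 ≤ ρ, ρ′ ≤ 1`, (e1) below the top. [bookkeeping] -/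
theorem topGap2ShellAtLevel_grids_nonneg (hζ0 : ∀ p g k s Pl Ql RS U V', 0 ≤ ϑ.ζ p g k s Pl Ql RS U V') (hζm : ZetaMeasurable F N ϑ.ζ)
    (hζ1 : IsZetaAbsLeOne F N ϑ.ν ϑ.τ9.M ϑ.ζ) {ρ ρ' : ℝ} (hρ0 : 0 ≤ ρ) (hρ1 : ρ ≤ 1) (hρ'0 : 0 ≤ ρ') (hρ'1 : ρ' ≤ 1) (ja kb i j : ℕ) (t : ℝ)
    (hint : ∀ k, k < p.K → ∀ s : SeqOfRecord F ϑ.ν ϑ.τ9.M g p.K k,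
      Integrable (fun U => chiSeqOfRecord F N ϑ.ν ϑ.τ9.M g p.K k s U * dressedSlotsOfDatum₉ F N ϑ D g₀ os t p g k s U) (fieldMeasure (F.P p.K) k (SU N))) :
    ∀ (j' : ℕ), j' = p.K → ∀ s : SeqOfRecord F ϑ.ν ϑ.τ9.M g p.K j',
      0 ≤ topGap2ShellAtLevel F N ϑ D g₀ os p g (cutGrid ϑ.ν g ja ρ (i + 2)) (cutGrid ϑ.ν g ja ρ (i + 1)) (cutGrid ϑ.ν g ja ρ i)
        (bCutGrid ϑ.ν ϑ.A₁ g kb ρ' (j + 2)) (bCutGrid ϑ.ν ϑ.A₁ g kb ρ' (j + 1)) (bCutGrid ϑ.ν ϑ.A₁ g kb ρ' j) t j' s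
  | 0, _, _ => le_rfl
  | k + 1, hk, s' => topGap2ShellAt_grids_nonneg F N ϑ D g₀ os p g k hk hζ0 hζm hζ1 hρ0 hρ1 hρ'0 hρ'1 ja kb i j t (hint k (by omega)) s'

/-- `0 ≤` the a-majorant of a grid collar at every level, ANY sign of the base (`0 ≤ ζ`). [bookkeeping] -/
theorem majorantA2AtLevel_grid_nonneg (hζ0 : ∀ p g k s Pl Ql RS U V', 0 ≤ ϑ.ζ p g k s Pl Ql RS U V') (ja : ℕ) {ρ : ℝ} (hρ0 : 0 ≤ ρ) (hρ1 : ρ ≤ 1) (i : ℕ) (t : ℝ) :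
    ∀ j' : ℕ, 0 ≤ majorantA2AtLevel F N ϑ D g₀ os p g (cutGrid ϑ.ν g ja ρ (i + 2)) (cutGrid ϑ.ν g ja ρ i) t j'
  | 0 => le_rfl
  | k + 1 => majorantA_grid_nonneg F N ϑ D g₀ os p g k hζ0 ja hρ0 hρ1 i t

/-- `0 ≤` the b-majorant of a grid collar at every level, ANY sign of the base (`0 ≤ ζ`). [bookkeeping] -/
theorem majorantB2AtLevel_grid_nonneg (hζ0 : ∀ p g k s Pl Ql RS U V', 0 ≤ ϑ.ζ p g k s Pl Ql RS U V') (kb : ℕ) {ρ' : ℝ} (hρ'0 : 0 ≤ ρ') (hρ'1 : ρ' ≤ 1) (j : ℕ) (t : ℝ) :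
    ∀ j' : ℕ, 0 ≤ majorantB2AtLevel F N ϑ D g₀ os p g (bCutGrid ϑ.ν ϑ.A₁ g kb ρ' (j + 2)) (bCutGrid ϑ.ν ϑ.A₁ g kb ρ' j) t j'
  | 0 => le_rfl
  | k + 1 => majorantB_grid_nonneg F N ϑ D g₀ os p g k hζ0 kb hρ'0 hρ'1 j t

end LevelSF2

section LiveSF2

variable {F : T4Family} {N : ℕ} [NeZero N]

/-- ★★ **THE TWO-COLLAR SHELLS ALONG THE GRIDS, SUMMED OVER THE TOP HISTORIES, ARE BELOW THE a-MAJORANT PLUS THE b-MAJORANT, AT EVERY LEVEL, ANY SIGNS** (`j′ = p.K`; a-grid base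
`ja`, b-grid base `kb`, `0 ≤ ρ, ρ′ ≤ 1`) on the live-selector line — FILE 14's `sum_topGap2ShellAtLevel_le_majorants_of_liveSel` with the order rows replaced by the grids.
[bookkeeping] -/
theorem sum_topGap2ShellAtLevel_grids_le_majorants_of_liveSel (θ : Stage13HParams F N) (hP : θ.Provisos₁₃CoPH F N) (E : B12.RunParams → ℝ)
    (hsel : θ.ppSel = ppSelLiveOfRecord F N θ.ν θ.τ9 E (wOfRecord₉ F N θ.toStage9Params)) (hζm : ZetaMeasurable F N θ.ζ) (g₀ : ℕ → ℝ) (os : List (ULoop F))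
    {p : B12.RunParams} {g : ℕ → ℝ} (hg : g 0 = g₀ p.K) {ρ ρ' : ℝ} (hρ0 : 0 ≤ ρ) (hρ1 : ρ ≤ 1) (hρ'0 : 0 ≤ ρ') (hρ'1 : ρ' ≤ 1) (ja kb i j : ℕ) (t : ℝ) :
    ∀ j' : ℕ, j' = p.K → ∑ s, topGap2ShellAtLevel F N θ.toStage9Params (datumOfRecord₁₃CoPH F N θ hP) g₀ os p g (cutGrid θ.ν g ja ρ (i + 2)) (cutGrid θ.ν g ja ρ (i + 1))
        (cutGrid θ.ν g ja ρ i) (bCutGrid θ.ν θ.A₁ g kb ρ' (j + 2)) (bCutGrid θ.ν θ.A₁ g kb ρ' (j + 1)) (bCutGrid θ.ν θ.A₁ g kb ρ' j) t j' s ≤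
      majorantA2AtLevel F N θ.toStage9Params (datumOfRecord₁₃CoPH F N θ hP) g₀ os p g (cutGrid θ.ν g ja ρ (i + 2)) (cutGrid θ.ν g ja ρ i) t j' +
        majorantB2AtLevel F N θ.toStage9Params (datumOfRecord₁₃CoPH F N θ hP) g₀ os p g (bCutGrid θ.ν θ.A₁ g kb ρ' (j + 2)) (bCutGrid θ.ν θ.A₁ g kb ρ' j) t j' := by
  have hζ0 : ∀ p g k s Pl Ql RS U V', 0 ≤ θ.ζ p g k s Pl Ql RS U V' :=
    fun p g k s Pl Ql RS U V' => zetaOfRecord_nonneg F N θ.ν θ.τ9.M hP.zetaUnity hP.zetaAbs p g k s Pl Ql RS U V'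
  have hU : LocalBgMeasurable F N θ.ν := localBgMeasurable F N θ.ν
  have hD : (datumOfRecord₁₃CoPH F N θ hP).AvgMeasurable := (isPrintedAveraged_datumOfRecord₁₃CoPH F N θ hP).avgMeasurable
  intro j' hj'
  cases j' with
  | zero => simp
  | succ k =>
    simp only [topGap2ShellAtLevel_succ, majorantA2AtLevel_succ, majorantB2AtLevel_succ]
    exact sum_topGap2ShellAt_grids_le_majorants F N θ.toStage9Params (datumOfRecord₁₃CoPH F N θ hP) g₀ os p g k hj' hζ0 hζm hP.zetaAbs hP.zetaUnity hρ0 hρ1 hρ'0 hρ'1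
      ja kb i j t (fun s => integrable_chi_mul_dressedSlots_of_ppSelLive θ.toStage9Params E hsel hU hζm hζ0 hP.zetaAbs _ hD g₀ os hg t k s)

/-! ## §E5 At the doubly-gapped reading: the bound at the two SEPARATELY selected depths, sign-free -/

/-- ★★★ **BOTH RUNS' TWO-COLLAR SHELL MASSES AT THE SELECTED DEPTH PAIR `(i⋆, j⋆)` ARE `≤ 4(2L^m)⁴(1∕(n₁+1) + 1∕(n₂+1)) ×` THE RUNS' PARTITION FUNCTIONS — SIGN-FREE**: FILE 14's
`gap2ShellSum_selDepths_le` with its four sign rows `hεA hεB hδA hδB` REMOVED.  Rows: `hsel`, (H-ζ), `0 ≤ ρ_K, ρ′_K ≤ 1`; NO anti-concentration, NO estimate of Bałaban's (S2's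
`argmin_badness_bounds` on the two runs' a-majorants and, INDEPENDENTLY, on their b-majorants — their signs and their bound `Σ shell2 ≤ Mᵃ + Mᵇ` now from the sign-free grid lemmas).
[bookkeeping] -/
theorem gap2ShellSum_selDepths_le_signFree (K₀ : ℕ) (θ : Stage13HParams F N) (hP : θ.Provisos₁₃CoPH F N) (g₀ : ℕ → ℝ) (os : List (ULoop F)) (E : B12.RunParams → ℝ)
    (hsel : θ.ppSel = ppSelLiveOfRecord F N θ.ν θ.τ9 E (wOfRecord₉ F N θ.toStage9Params)) (hζm : ZetaMeasurable F N θ.ζ)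
    {ρ ρ' : ℕ → ℝ} (hρ0 : ∀ K, 0 ≤ ρ K) (hρ1 : ∀ K, ρ K ≤ 1) (hρ'0 : ∀ K, 0 ≤ ρ' K) (hρ'1 : ∀ K, ρ' K ≤ 1) (n₁ n₂ K : ℕ) (t : ℝ) :
    gap2ShellSumA₁₃ θ hP K₀ g₀ os ρ ρ' K (selDepthA2₁₃ θ hP K₀ g₀ os ρ n₁ K t) (selDepthB2₁₃ θ hP K₀ g₀ os ρ' n₂ K t) t ≤
        4 * (2 * (F.L : ℝ) ^ F.m) ^ 4 * (1 / (n₁ + 1 : ℕ) + 1 / (n₂ + 1 : ℕ)) * T4GenFunBounds.schemeZ ((datumOfRecord₁₃CoPH F N θ hP).scheme g₀) os (K₀ + K) t ∧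
      gap2ShellSumB₁₃ θ hP K₀ g₀ os ρ ρ' K (selDepthA2₁₃ θ hP K₀ g₀ os ρ n₁ K t) (selDepthB2₁₃ θ hP K₀ g₀ os ρ' n₂ K t) t ≤
        4 * (2 * (F.L : ℝ) ^ F.m) ^ 4 * (1 / (n₁ + 1 : ℕ) + 1 / (n₂ + 1 : ℕ)) *
          T4GenFunBounds.schemeZ ((datumOfRecord₁₃CoPH F N θ hP).scheme g₀) os (K₀ + K + 1) t := by
  have hζ0 : ∀ p g k s Pl Ql RS U V', 0 ≤ θ.ζ p g k s Pl Ql RS U V' :=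
    fun p g k s Pl Ql RS U V' => zetaOfRecord_nonneg F N θ.ν θ.τ9.M hP.zetaUnity hP.zetaAbs p g k s Pl Ql RS U V'
  have hU : LocalBgMeasurable F N θ.ν := localBgMeasurable F N θ.ν
  set X : ℝ := (2 * (F.L : ℝ) ^ F.m) ^ 4 with hX
  set ZA : ℝ := T4GenFunBounds.schemeZ ((datumOfRecord₁₃CoPH F N θ hP).scheme g₀) os (K₀ + K) t with hZA
  set ZB : ℝ := T4GenFunBounds.schemeZ ((datumOfRecord₁₃CoPH F N θ hP).scheme g₀) os (K₀ + K + 1) t with hZB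
  set i := selDepthA2₁₃ θ hP K₀ g₀ os ρ n₁ K t with hi
  set j := selDepthB2₁₃ θ hP K₀ g₀ os ρ' n₂ K t with hj
  -- the two partition functions are nonnegative (E1 at level 0)
  have hZ : ∀ (p : B12.RunParams) (g : ℕ → ℝ), g 0 = g₀ p.K → 0 ≤ T4GenFunBounds.schemeZ ((datumOfRecord₁₃CoPH F N θ hP).scheme g₀) os p.K t := by
    intro p g hg
    rw [← sum_classWeightOfDatum₉_datumOfRecord₁₃CoPH_eq_schemeZ_of_ppSelLive θ hP E hsel hU hζm hζ0 g₀ os hg t 0 (Nat.zero_le _)]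
    exact Finset.sum_nonneg fun s _ => classWeightOfDatum₉_nonneg' F N θ.toStage9Params (datumOfRecord₁₃CoPH F N θ hP) g₀ os p g 0
      (wOfRecord₉_nonneg θ.toStage9Params hζ0 p g) t s
  have hZA0 : 0 ≤ ZA := hZ (runA₁₃ F K₀ g₀ K) _ (histA₁₃_zero θ K₀ g₀ K)
  have hZB0 : 0 ≤ ZB := hZ (runB₁₃ F K₀ g₀ K) _ (histB₁₃_zero θ K₀ g₀ K)
  -- the four majorant families: their signs (ANY sign of the bases) and their counts
  have hfaA0 : ∀ i, 0 ≤ majA2SumA₁₃ θ hP K₀ g₀ os ρ K i t := fun i =>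
    majorantA2AtLevel_grid_nonneg F N θ.toStage9Params (datumOfRecord₁₃CoPH F N θ hP) g₀ os _ _ hζ0 _ (hρ0 K) (hρ1 K) i t _
  have hfaB0 : ∀ i, 0 ≤ majA2SumB₁₃ θ hP K₀ g₀ os ρ K i t := fun i =>
    majorantA2AtLevel_grid_nonneg F N θ.toStage9Params (datumOfRecord₁₃CoPH F N θ hP) g₀ os _ _ hζ0 _ (hρ0 K) (hρ1 K) i t _
  have hfbA0 : ∀ j, 0 ≤ majB2SumA₁₃ θ hP K₀ g₀ os ρ' K j t := fun j =>
    majorantB2AtLevel_grid_nonneg F N θ.toStage9Params (datumOfRecord₁₃CoPH F N θ hP) g₀ os _ _ hζ0 _ (hρ'0 K) (hρ'1 K) j t _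
  have hfbB0 : ∀ j, 0 ≤ majB2SumB₁₃ θ hP K₀ g₀ os ρ' K j t := fun j =>
    majorantB2AtLevel_grid_nonneg F N θ.toStage9Params (datumOfRecord₁₃CoPH F N θ hP) g₀ os _ _ hζ0 _ (hρ'0 K) (hρ'1 K) j t _
  have hsaA : ∑ i ∈ Finset.range (n₁ + 1), majA2SumA₁₃ θ hP K₀ g₀ os ρ K i t ≤ 2 * X * ZA := by
    have h := sum_range_majorantA2AtLevel_le_of_liveSel θ hP E hsel hζm g₀ os (p := runA₁₃ F K₀ g₀ K) (histA₁₃_zero θ K₀ g₀ K) (ρ K) (n₁ + 1) t (K₀ + K) rfl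
    rw [YMDAG.UVSplit.runA₁₃_K] at h; exact h
  have hsaB : ∑ i ∈ Finset.range (n₁ + 1), majA2SumB₁₃ θ hP K₀ g₀ os ρ K i t ≤ 2 * X * ZB := by
    have h := sum_range_majorantA2AtLevel_le_of_liveSel θ hP E hsel hζm g₀ os (p := runB₁₃ F K₀ g₀ K) (histB₁₃_zero θ K₀ g₀ K) (ρ K) (n₁ + 1) t (K₀ + K + 1) rfl
    rw [YMDAG.UVSplit.runB₁₃_K] at h; exact h
  have hsbA : ∑ j ∈ Finset.range (n₂ + 1), majB2SumA₁₃ θ hP K₀ g₀ os ρ' K j t ≤ 2 * X * ZA := by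
    have h := sum_range_majorantB2AtLevel_le_of_liveSel θ hP E hsel hζm g₀ os (p := runA₁₃ F K₀ g₀ K) (histA₁₃_zero θ K₀ g₀ K)
      (bCutGrid θ.ν θ.A₁ (histA₁₃ θ K₀ g₀ K) (K₀ + K - 1) (ρ' K)) (n₂ + 1) t (K₀ + K) rfl
    rw [YMDAG.UVSplit.runA₁₃_K] at h; exact h
  have hsbB : ∑ j ∈ Finset.range (n₂ + 1), majB2SumB₁₃ θ hP K₀ g₀ os ρ' K j t ≤ 2 * X * ZB := by
    have h := sum_range_majorantB2AtLevel_le_of_liveSel θ hP E hsel hζm g₀ os (p := runB₁₃ F K₀ g₀ K) (histB₁₃_zero θ K₀ g₀ K)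
      (bCutGrid θ.ν θ.A₁ (histB₁₃ θ K₀ g₀ K) (K₀ + K) (ρ' K)) (n₂ + 1) t (K₀ + K + 1) rfl
    rw [YMDAG.UVSplit.runB₁₃_K] at h; exact h
  -- the two argmins
  have hspecA := selDepthA2₁₃_spec θ hP K₀ g₀ os ρ n₁ K t
  have hspecB := selDepthB2₁₃_spec θ hP K₀ g₀ os ρ' n₂ K t
  obtain ⟨haA, haB⟩ := argmin_badness_bounds (f := fun i => majA2SumA₁₃ θ hP K₀ g₀ os ρ K i t) (g := fun i => majA2SumB₁₃ θ hP K₀ g₀ os ρ K i t)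
    hfaA0 hfaB0 hZA0 hZB0 (by positivity) hsaA hsaB hspecA.1 hspecA.2
  obtain ⟨hbA, hbB⟩ := argmin_badness_bounds (f := fun j => majB2SumA₁₃ θ hP K₀ g₀ os ρ' K j t) (g := fun j => majB2SumB₁₃ θ hP K₀ g₀ os ρ' K j t)
    hfbA0 hfbB0 hZA0 hZB0 (by positivity) hsbA hsbB hspecB.1 hspecB.2
  -- `Σ shell2 ≤ Mᵃ + Mᵇ` in each run at the selected letters, sign-free
  have hMA := sum_topGap2ShellAtLevel_grids_le_majorants_of_liveSel θ hP E hsel hζm g₀ os (p := runA₁₃ F K₀ g₀ K) (histA₁₃_zero θ K₀ g₀ K)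
    (hρ0 K) (hρ1 K) (hρ'0 K) (hρ'1 K) (K₀ + K) (K₀ + K - 1) i j t (K₀ + K) rfl
  have hMB := sum_topGap2ShellAtLevel_grids_le_majorants_of_liveSel θ hP E hsel hζm g₀ os (p := runB₁₃ F K₀ g₀ K) (histB₁₃_zero θ K₀ g₀ K)
    (hρ0 K) (hρ1 K) (hρ'0 K) (hρ'1 K) (K₀ + K + 1) (K₀ + K) i j t (K₀ + K + 1) rfl
  have hnum : ∀ Z : ℝ, 2 * (2 * X) / ((n₁ + 1 : ℕ) : ℝ) * Z + 2 * (2 * X) / ((n₂ + 1 : ℕ) : ℝ) * Z = 4 * X * (1 / (n₁ + 1 : ℕ) + 1 / (n₂ + 1 : ℕ)) * Z :=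
    fun Z => by ring
  have hcardA : (Finset.range (n₁ + 1)).card = n₁ + 1 := Finset.card_range _
  have hcardB : (Finset.range (n₂ + 1)).card = n₂ + 1 := Finset.card_range _
  refine ⟨?_, ?_⟩
  · calc gap2ShellSumA₁₃ θ hP K₀ g₀ os ρ ρ' K i j t ≤ majA2SumA₁₃ θ hP K₀ g₀ os ρ K i t + majB2SumA₁₃ θ hP K₀ g₀ os ρ' K j t := hMA
      _ ≤ 2 * (2 * X) / ((n₁ + 1 : ℕ) : ℝ) * ZA + 2 * (2 * X) / ((n₂ + 1 : ℕ) : ℝ) * ZA := by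
          have h1 : majA2SumA₁₃ θ hP K₀ g₀ os ρ K i t ≤ 2 * (2 * X) / ((n₁ + 1 : ℕ) : ℝ) * ZA := by simpa using haA
          have h2 : majB2SumA₁₃ θ hP K₀ g₀ os ρ' K j t ≤ 2 * (2 * X) / ((n₂ + 1 : ℕ) : ℝ) * ZA := by simpa using hbA
          linarith
      _ = 4 * X * (1 / (n₁ + 1 : ℕ) + 1 / (n₂ + 1 : ℕ)) * ZA := hnum ZA
  · calc gap2ShellSumB₁₃ θ hP K₀ g₀ os ρ ρ' K i j t ≤ majA2SumB₁₃ θ hP K₀ g₀ os ρ K i t + majB2SumB₁₃ θ hP K₀ g₀ os ρ' K j t := hMB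
      _ ≤ 2 * (2 * X) / ((n₁ + 1 : ℕ) : ℝ) * ZB + 2 * (2 * X) / ((n₂ + 1 : ℕ) : ℝ) * ZB := by
          have h1 : majA2SumB₁₃ θ hP K₀ g₀ os ρ K i t ≤ 2 * (2 * X) / ((n₁ + 1 : ℕ) : ℝ) * ZB := by simpa using haB
          have h2 : majB2SumB₁₃ θ hP K₀ g₀ os ρ' K j t ≤ 2 * (2 * X) / ((n₂ + 1 : ℕ) : ℝ) * ZB := by simpa using hbB
          linarith
      _ = 4 * X * (1 / (n₁ + 1 : ℕ) + 1 / (n₂ + 1 : ℕ)) * ZB := hnum ZB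

/-- ★★★ **(M1)-FREE NE7c AT THE PAIR-LETTERED TERMS OF THE TWO RUNS OF RECORD, ONE COMMON (3.2) DEPTH AND ONE COMMON (3.3) DEPTH — SIGN-FREE**: FILE 12's
`exists_common_depths_topGap2Shell_le_of_liveSel` (p629800) with its four sign rows REMOVED.  Rows: `hsel`, (H-ζ), `0 ≤ ρ, ρ′ ≤ 1`; NO anti-concentration, NO estimate of
Bałaban's. [bookkeeping] -/
theorem exists_common_depths_topGap2Shell_le_of_liveSel_signFree (K₀ : ℕ) (θ : Stage13HParams F N) (hP : θ.Provisos₁₃CoPH F N) (g₀ : ℕ → ℝ) (os : List (ULoop F))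
    (E : B12.RunParams → ℝ) (hsel : θ.ppSel = ppSelLiveOfRecord F N θ.ν θ.τ9 E (wOfRecord₉ F N θ.toStage9Params)) (hζm : ZetaMeasurable F N θ.ζ)
    (K kA kB : ℕ) (hkA : kA + 1 = K₀ + K) (hkB : kB + 1 = K₀ + K + 1) {ρ ρ' : ℝ} (hρ0 : 0 ≤ ρ) (hρ1 : ρ ≤ 1) (hρ'0 : 0 ≤ ρ') (hρ'1 : ρ' ≤ 1) (n₁ n₂ : ℕ) (t : ℝ) :
    ∃ i ∈ Finset.range (n₁ + 1), ∃ j ∈ Finset.range (n₂ + 1),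
      ∑ s', topGap2ShellAt F N θ.toStage9Params (datumOfRecord₁₃CoPH F N θ hP) g₀ os (runA₁₃ F K₀ g₀ K) (histA₁₃ θ K₀ g₀ K) kA
            (cutGrid θ.ν (histA₁₃ θ K₀ g₀ K) (kA + 1) ρ (i + 2)) (cutGrid θ.ν (histA₁₃ θ K₀ g₀ K) (kA + 1) ρ (i + 1)) (cutGrid θ.ν (histA₁₃ θ K₀ g₀ K) (kA + 1) ρ i)
            (bCutGrid θ.ν θ.A₁ (histA₁₃ θ K₀ g₀ K) kA ρ' (j + 2)) (bCutGrid θ.ν θ.A₁ (histA₁₃ θ K₀ g₀ K) kA ρ' (j + 1)) (bCutGrid θ.ν θ.A₁ (histA₁₃ θ K₀ g₀ K) kA ρ' j)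
            t s' ≤
          4 * (2 * (F.L : ℝ) ^ F.m) ^ 4 * (1 / (n₁ + 1 : ℕ) + 1 / (n₂ + 1 : ℕ)) *
            ∑ s, classWeightOfDatum₉ F N θ.toStage9Params (datumOfRecord₁₃CoPH F N θ hP) g₀ os (runA₁₃ F K₀ g₀ K) (histA₁₃ θ K₀ g₀ K) kA t s ∧
        ∑ s', topGap2ShellAt F N θ.toStage9Params (datumOfRecord₁₃CoPH F N θ hP) g₀ os (runB₁₃ F K₀ g₀ K) (histB₁₃ θ K₀ g₀ K) kB
            (cutGrid θ.ν (histB₁₃ θ K₀ g₀ K) (kB + 1) ρ (i + 2)) (cutGrid θ.ν (histB₁₃ θ K₀ g₀ K) (kB + 1) ρ (i + 1)) (cutGrid θ.ν (histB₁₃ θ K₀ g₀ K) (kB + 1) ρ i)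
            (bCutGrid θ.ν θ.A₁ (histB₁₃ θ K₀ g₀ K) kB ρ' (j + 2)) (bCutGrid θ.ν θ.A₁ (histB₁₃ θ K₀ g₀ K) kB ρ' (j + 1)) (bCutGrid θ.ν θ.A₁ (histB₁₃ θ K₀ g₀ K) kB ρ' j)
            t s' ≤
          4 * (2 * (F.L : ℝ) ^ F.m) ^ 4 * (1 / (n₁ + 1 : ℕ) + 1 / (n₂ + 1 : ℕ)) *
            ∑ s, classWeightOfDatum₉ F N θ.toStage9Params (datumOfRecord₁₃CoPH F N θ hP) g₀ os (runB₁₃ F K₀ g₀ K) (histB₁₃ θ K₀ g₀ K) kB t s := by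
  have hζ0 : ∀ p g k s Pl Ql RS U V', 0 ≤ θ.ζ p g k s Pl Ql RS U V' :=
    fun p g k s Pl Ql RS U V' => zetaOfRecord_nonneg F N θ.ν θ.τ9.M hP.zetaUnity hP.zetaAbs p g k s Pl Ql RS U V'
  have hU : LocalBgMeasurable F N θ.ν := localBgMeasurable F N θ.ν
  have hD : (datumOfRecord₁₃CoPH F N θ hP).AvgMeasurable := (isPrintedAveraged_datumOfRecord₁₃CoPH F N θ hP).avgMeasurable
  have hkA' : kA + 1 = (runA₁₃ F K₀ g₀ K).K := by rw [YMDAG.UVSplit.runA₁₃_K]; exact hkA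
  have hkB' : kB + 1 = (runB₁₃ F K₀ g₀ K).K := by rw [YMDAG.UVSplit.runB₁₃_K]; exact hkB
  exact exists_common_depths_topGap2Shell_le_signFree F N θ.toStage9Params (datumOfRecord₁₃CoPH F N θ hP) g₀ os (runA₁₃ F K₀ g₀ K) (histA₁₃ θ K₀ g₀ K) kA hkA'
    (runB₁₃ F K₀ g₀ K) (histB₁₃ θ K₀ g₀ K) kB hkB' hζ0 hζm hP.zetaAbs hP.zetaUnity hρ0 hρ1 hρ'0 hρ'1 n₁ n₂ t
    (fun s => integrable_chi_mul_dressedSlots_of_ppSelLive θ.toStage9Params E hsel hU hζm hζ0 hP.zetaAbs _ hD g₀ os (histA₁₃_zero θ K₀ g₀ K) t kA s)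
    (fun s => integrable_chi_mul_dressedSlots_of_ppSelLive θ.toStage9Params E hsel hU hζm hζ0 hP.zetaAbs _ hD g₀ os (histB₁₃_zero θ K₀ g₀ K) t kB s)

/-! ## §F3 `ShellWeightBound` at the doubly-gapped carriers and at the reading, and the K5 conjunct's ∀-shape — sign-free -/

/-- ★★★ **N21's OUTPUT SHAPE AT THE DOUBLY-GAPPED CARRIERS — BOTH INDICATOR FAMILIES OF THE LAST 𝐓-STEP, BOTH SIDES OF BOTH CUTS BANDED, (M1)-FREE, SIGN-FREE.**  At a `CoPH`-keyed
Stage-13 tuple on the live-selector line (`hsel`), under (H-ζ), with the dial rows `0 ≤ ρ_K, ρ′_K ≤ 1` and `Summable (K ↦ 1∕(n₁ K+1) + 1∕(n₂ K+1))` ONLY: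
`ShellWeightBound 1 (classSet₁₃ θ K₀ g₀) (gapWeight2A₁₃ …) (gapWeight2B₁₃ …) (gapShell2A₁₃ …) (gapShell2B₁₃ …) (K ↦ 4(2L^m)⁴·(1∕(n₁ K+1) + 1∕(n₂ K+1)))` — every field PROVED;
FILE 15's `shellWeightBound_carriersGap2₁₃` with `hεA hεB hδA hδB` REMOVED. [bookkeeping] -/
theorem shellWeightBound_carriersGap2₁₃_signFree (K₀ : ℕ) (θ : Stage13HParams F N) (hP : θ.Provisos₁₃CoPH F N) (g₀ : ℕ → ℝ) (os : List (ULoop F))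
    (E : B12.RunParams → ℝ) (hsel : θ.ppSel = ppSelLiveOfRecord F N θ.ν θ.τ9 E (wOfRecord₉ F N θ.toStage9Params)) (hζm : ZetaMeasurable F N θ.ζ)
    {ρ ρ' : ℕ → ℝ} {n₁ n₂ : ℕ → ℕ} (hρ0 : ∀ K, 0 ≤ ρ K) (hρ1 : ∀ K, ρ K ≤ 1) (hρ'0 : ∀ K, 0 ≤ ρ' K) (hρ'1 : ∀ K, ρ' K ≤ 1)
    (hn : Summable (fun K => 1 / ((n₁ K : ℝ) + 1) + 1 / ((n₂ K : ℝ) + 1))) :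
    ShellWeightBound 1 (classSet₁₃ θ K₀ g₀) (gapWeight2A₁₃ θ hP K₀ g₀ os ρ ρ' n₁ n₂) (gapWeight2B₁₃ θ hP K₀ g₀ os ρ ρ' n₁ n₂) (gapShell2A₁₃ θ hP K₀ g₀ os ρ ρ' n₁ n₂)
      (gapShell2B₁₃ θ hP K₀ g₀ os ρ ρ' n₁ n₂) (fun K => 4 * (2 * (F.L : ℝ) ^ F.m) ^ 4 * (1 / ((n₁ K : ℝ) + 1) + 1 / ((n₂ K : ℝ) + 1))) := by
  have hζ0 : ∀ p g k s Pl Ql RS U V', 0 ≤ θ.ζ p g k s Pl Ql RS U V' :=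
    fun p g k s Pl Ql RS U V' => zetaOfRecord_nonneg F N θ.ν θ.τ9.M hP.zetaUnity hP.zetaAbs p g k s Pl Ql RS U V'
  have hU : LocalBgMeasurable F N θ.ν := localBgMeasurable F N θ.ν
  have hD : (datumOfRecord₁₃CoPH F N θ hP).AvgMeasurable := (isPrintedAveraged_datumOfRecord₁₃CoPH F N θ hP).avgMeasurable
  have hνbar : 0 ≤ 4 * (2 * (F.L : ℝ) ^ F.m) ^ 4 := by positivity
  have hconst : ∀ K, 4 * (2 * (F.L : ℝ) ^ F.m) ^ 4 * (1 / (n₁ K + 1 : ℕ) + 1 / (n₂ K + 1 : ℕ)) =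
      4 * (2 * (F.L : ℝ) ^ F.m) ^ 4 * (1 / ((n₁ K : ℝ) + 1) + 1 / ((n₂ K : ℝ) + 1)) := fun K => by push_cast; ring
  have hintA : ∀ K k, k < (runA₁₃ F K₀ g₀ K).K → ∀ s : SeqOfRecord F θ.ν θ.τ9.M (histA₁₃ θ K₀ g₀ K) (runA₁₃ F K₀ g₀ K).K k, ∀ t : ℝ,
      Integrable (fun U => chiSeqOfRecord F N θ.ν θ.τ9.M (histA₁₃ θ K₀ g₀ K) (runA₁₃ F K₀ g₀ K).K k s U *
        dressedSlotsOfDatum₉ F N θ.toStage9Params (datumOfRecord₁₃CoPH F N θ hP) g₀ os t (runA₁₃ F K₀ g₀ K) (histA₁₃ θ K₀ g₀ K) k s U)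
        (fieldMeasure (F.P (runA₁₃ F K₀ g₀ K).K) k (SU N)) :=
    fun K k _ s t => integrable_chi_mul_dressedSlots_of_ppSelLive θ.toStage9Params E hsel hU hζm hζ0 hP.zetaAbs _ hD g₀ os (histA₁₃_zero θ K₀ g₀ K) t k s
  have hintB : ∀ K k, k < (runB₁₃ F K₀ g₀ K).K → ∀ s : SeqOfRecord F θ.ν θ.τ9.M (histB₁₃ θ K₀ g₀ K) (runB₁₃ F K₀ g₀ K).K k, ∀ t : ℝ,
      Integrable (fun U => chiSeqOfRecord F N θ.ν θ.τ9.M (histB₁₃ θ K₀ g₀ K) (runB₁₃ F K₀ g₀ K).K k s U *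
        dressedSlotsOfDatum₉ F N θ.toStage9Params (datumOfRecord₁₃CoPH F N θ hP) g₀ os t (runB₁₃ F K₀ g₀ K) (histB₁₃ θ K₀ g₀ K) k s U)
        (fieldMeasure (F.P (runB₁₃ F K₀ g₀ K).K) k (SU N)) :=
    fun K k _ s t => integrable_chi_mul_dressedSlots_of_ppSelLive θ.toStage9Params E hsel hU hζm hζ0 hP.zetaAbs _ hD g₀ os (histB₁₃_zero θ K₀ g₀ K) t k s
  letI : ∀ Kc, DecidableEq (SiteSeqKey F Kc) := fun _ => Classical.decEq _
  refine
    { nonneg := fun K => mul_nonneg hνbar (by positivity)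
      summable := hn.mul_left _
      sh_nonneg_left := fun K t _ x _ => Finset.sum_nonneg fun s _ =>
        topGap2ShellAtLevel_grids_nonneg F N θ.toStage9Params (datumOfRecord₁₃CoPH F N θ hP) g₀ os (runA₁₃ F K₀ g₀ K) (histA₁₃ θ K₀ g₀ K) hζ0 hζm hP.zetaAbs
          (hρ0 K) (hρ1 K) (hρ'0 K) (hρ'1 K) _ _ _ _ t (fun k hk s => hintA K k hk s t) (K₀ + K) rfl s
      sh_le_left := fun K t _ x _ => Finset.sum_le_sum fun s _ =>
        topGap2ShellAtLevel_le F N θ.toStage9Params (datumOfRecord₁₃CoPH F N θ hP) g₀ os (runA₁₃ F K₀ g₀ K) (histA₁₃ θ K₀ g₀ K) hζ0 _ _ _ _ _ _ t (K₀ + K) s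
      sh_nonneg_right := fun K t _ x _ => Finset.sum_nonneg fun s' _ =>
        topGap2ShellAtLevel_grids_nonneg F N θ.toStage9Params (datumOfRecord₁₃CoPH F N θ hP) g₀ os (runB₁₃ F K₀ g₀ K) (histB₁₃ θ K₀ g₀ K) hζ0 hζm hP.zetaAbs
          (hρ0 K) (hρ1 K) (hρ'0 K) (hρ'1 K) _ _ _ _ t (fun k hk s => hintB K k hk s t) (K₀ + K + 1) rfl s'
      sh_le_right := fun K t _ x _ => Finset.sum_le_sum fun s' _ =>
        topGap2ShellAtLevel_le F N θ.toStage9Params (datumOfRecord₁₃CoPH F N θ hP) g₀ os (runB₁₃ F K₀ g₀ K) (histB₁₃ θ K₀ g₀ K) hζ0 _ _ _ _ _ _ t (K₀ + K + 1) s'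
      left := fun K t _ => ?_
      right := fun K t _ => ?_ }
  · rw [sum_classSet₁₃_gapShell2A₁₃, sum_classSet₁₃_gapWeight2A₁₃_eq_schemeZ K₀ θ hP g₀ os E hsel hζm, ← hconst K]
    exact (gap2ShellSum_selDepths_le_signFree K₀ θ hP g₀ os E hsel hζm hρ0 hρ1 hρ'0 hρ'1 (n₁ K) (n₂ K) K t).1
  · rw [sum_classSet₁₃_gapShell2B₁₃, sum_classSet₁₃_gapWeight2B₁₃_eq_schemeZ K₀ θ hP g₀ os E hsel hζm, ← hconst K]
    exact (gap2ShellSum_selDepths_le_signFree K₀ θ hP g₀ os E hsel hζm hρ0 hρ1 hρ'0 hρ'1 (n₁ K) (n₂ K) K t).2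

/-- ★★★ **`KeyedShellWeight` AT THE DOUBLY-GAPPED READING, (M1)-FREE, SIGN-FREE**: on the live-selector line, under (H-ζ), with the dial rows and `Σ_K (1∕(n₁ K+1) + 1∕(n₂ K+1)) < ∞`
read at the tuple ONLY: `ShellWeightBound` AT `crGap2₁₃VAt N K₀ jcut ρ ρ′ n₁ n₂` — its `l₀, T, A, B, shA, shB` and its CANONICAL `Wsh` (n20-d's `shellWeightBound_wshInf`).  `jcut`
is not read. [bookkeeping] -/
theorem shellWeightBound_crGap2₁₃VAt_signFree (K₀ : ℕ) (jcut : ℕ → ℕ) (ρ ρ' : WidthLetter₁₃CoPH N) (n₁ n₂ : DepthLetter₁₃CoPH N) (θ : Stage13HParams F N)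
    (hP : θ.Provisos₁₃CoPH F N) (g₀ : ℕ → ℝ) (os : List (ULoop F)) (E : B12.RunParams → ℝ)
    (hsel : θ.ppSel = ppSelLiveOfRecord F N θ.ν θ.τ9 E (wOfRecord₉ F N θ.toStage9Params)) (hζm : ZetaMeasurable F N θ.ζ)
    (hρ0 : ∀ K, 0 ≤ ρ F θ hP g₀ os K) (hρ1 : ∀ K, ρ F θ hP g₀ os K ≤ 1) (hρ'0 : ∀ K, 0 ≤ ρ' F θ hP g₀ os K) (hρ'1 : ∀ K, ρ' F θ hP g₀ os K ≤ 1)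
    (hn : Summable (fun K => 1 / ((n₁ F θ hP g₀ os K : ℝ) + 1) + 1 / ((n₂ F θ hP g₀ os K : ℝ) + 1))) :
    ShellWeightBound (crGap2₁₃VAt N K₀ jcut ρ ρ' n₁ n₂ F θ hP g₀ os).l₀ (crGap2₁₃VAt N K₀ jcut ρ ρ' n₁ n₂ F θ hP g₀ os).T
      (crGap2₁₃VAt N K₀ jcut ρ ρ' n₁ n₂ F θ hP g₀ os).A (crGap2₁₃VAt N K₀ jcut ρ ρ' n₁ n₂ F θ hP g₀ os).B (crGap2₁₃VAt N K₀ jcut ρ ρ' n₁ n₂ F θ hP g₀ os).shA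
      (crGap2₁₃VAt N K₀ jcut ρ ρ' n₁ n₂ F θ hP g₀ os).shB (crGap2₁₃VAt N K₀ jcut ρ ρ' n₁ n₂ F θ hP g₀ os).Wsh :=
  shellWeightBound_wshInf (shellWeightBound_carriersGap2₁₃_signFree K₀ θ hP g₀ os E hsel hζm hρ0 hρ1 hρ'0 hρ'1 hn)

/-- ★★ **THE K3 STUB-2 CONJUNCT `KeyedShellWeight` AT `crGap2₁₃V`, IN THE SKELETON's ∀-SHAPE, MODULO THE DISPLAYED ROWS — SIGN-FREE** (live-selector pin, (H-ζ), the dial rows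
`0 ≤ ρ_K, ρ′_K ≤ 1`, `Σ_K (1∕(n₁ K+1) + 1∕(n₂ K+1)) < ∞` — and NOTHING about the signs of `ε`, `δ` at any `g₀`); the record object `crGap2₁₃V = crGap2₁₃VAt N 0` (`rfl`).
[bookkeeping] -/
theorem keyedShellWeight_shape_crGap2₁₃V_signFree (jcut : ℕ → ℕ) (ρ ρ' : WidthLetter₁₃CoPH N) (n₁ n₂ : DepthLetter₁₃CoPH N)
    (E : (F : T4Family) → Stage13HParams F N → (B12.RunParams → ℝ)) :
    ∀ (F : T4Family) (θ : Stage13HParams F N) (hP : θ.Provisos₁₃CoPH F N),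
      θ.ppSel = ppSelLiveOfRecord F N θ.ν θ.τ9 (E F θ) (wOfRecord₉ F N θ.toStage9Params) → ZetaMeasurable F N θ.ζ →
      ∀ (g₀ : ℕ → ℝ) (os : List (ULoop F)),
        (∀ K, 0 ≤ ρ F θ hP g₀ os K) → (∀ K, ρ F θ hP g₀ os K ≤ 1) → (∀ K, 0 ≤ ρ' F θ hP g₀ os K) → (∀ K, ρ' F θ hP g₀ os K ≤ 1) →
        Summable (fun K => 1 / ((n₁ F θ hP g₀ os K : ℝ) + 1) + 1 / ((n₂ F θ hP g₀ os K : ℝ) + 1)) →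
        ShellWeightBound (crGap2₁₃V N jcut ρ ρ' n₁ n₂ F θ hP g₀ os).l₀ (crGap2₁₃V N jcut ρ ρ' n₁ n₂ F θ hP g₀ os).T (crGap2₁₃V N jcut ρ ρ' n₁ n₂ F θ hP g₀ os).A
          (crGap2₁₃V N jcut ρ ρ' n₁ n₂ F θ hP g₀ os).B (crGap2₁₃V N jcut ρ ρ' n₁ n₂ F θ hP g₀ os).shA (crGap2₁₃V N jcut ρ ρ' n₁ n₂ F θ hP g₀ os).shB
          (crGap2₁₃V N jcut ρ ρ' n₁ n₂ F θ hP g₀ os).Wsh :=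
  fun F θ hP hsel hζm g₀ os hρ0 hρ1 hρ'0 hρ'1 hn =>
    shellWeightBound_crGap2₁₃VAt_signFree 0 jcut ρ ρ' n₁ n₂ θ hP g₀ os (E F θ) hsel hζm hρ0 hρ1 hρ'0 hρ'1 hn

end LiveSF2

end Summit.QuantumFields.YangMills.Theorems.N21GappedTopPair13CoPH

end
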